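import Literature.Probability.RandomPlanarGeometry.RestrictionLeftFillLaw
import Literature.Probability.RandomPlanarGeometry.RestrictionConfigEvents
import Literature.Probability.RandomPlanarGeometry.HalfPlaneAnchors
import Literature.Topology.PlaneTopology.EilenbergCriterion
import HarnessLib

/-!
# A simple path from `0` to `∞` in the upper half-plane is a configuration of `Ω`; its two sides

Deterministic geometry behind the sentence "which is `1/2` by symmetry" of the proof of
[LSW] Cor. 8.6 (p. 38) — the named fact
`Literature.Probability.RandomPlanarGeometry.measure_I_notMem_leftFilling_sle_eq_half`
(`SLEKappaRhoDriving`), for the SLE_{8/3} trace, a simple curve from `0` to `∞` in `ℍ`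
(Rohde–Schramm 2005) — after

* G. F. Lawler, O. Schramm, W. Werner, *Conformal restriction: the chordal case*, J. Amer. Math.
  Soc. **16** (2003) 917–955, arXiv:math/0209343 (**[LSW]**), Def. 3.1 (p. 10): "A simple
  example of a set `K ∈ Ω` is a simple curve `γ` from `0` to infinity in the upper half-plane";
  §2 p. 8 (the fillings `F^{ℝ₊}_ℍ`, `F^{ℝ₋}_ℍ`) and the proof of Cor. 8.6 (p. 38: "`i` ends up
  eventually to 'the right' of the right hand boundary", "which is `1/2` by symmetry").

Contents (all PROVED):

* `Literature.Probability.RandomPlanarGeometry.IsChordalSimplePath γ` — a **simple path from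
  `0` to `∞` in `ℍ`**: `γ : [0, ∞) → ℂ` continuous and injective, `γ 0 = 0`, `γ(t) ∈ ℍ` for
  `t > 0` (the tree's `Loewner.IsSimpleTrace`) and `|γ(t)| → ∞`;
* `IsChordalSimplePath.isConnected_compl_range` — **such a path does not separate the plane**:
  `ℂ ∖ γ[0, ∞)` is connected (the tree's `isConnected_compl_image_of_tendsto_cocompact` of
  `HalfPlaneAnchors` — inversion to a Jordan arc and `JordanArcSeparation_holds` — applied to
  the reparametrisation `x ↦ γ(x/(1 − x))` of `[0, 1)`);
* `IsChordalSimplePath.image_Ioi_mem_restrictionConfigs` — **[LSW]'s example**: `γ(0, ∞) ∈ Ω`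
  (relatively closed in `ℍ`, connected, closure meeting `ℝ` exactly at `0`, unbounded, connected
  complement of the closure); `IsChordalSimplePath.toConfig` is the configuration, a simple path
  in the sense of `RestrictionConfig.IsSimplePath`; the mirror image `t ↦ −conj (γ t)` is again
  such a path and its configuration is the reflection `σ` (`toConfig_negConj`);
* `RestrictionConfig.mem_rightDomain_or_mem_leftDomain` — **the two sides**: a point of `ℍ` off
  a configuration `K ∈ Ω` lies in the right domain or in the left domain of `K` (join it to its
  conjugate inside the connected open set `ℂ ∖ cl K`, Def. 3.1 (2); up to the first crossing of
  the real axis — at a nonzero real point — the path runs in `ℍ̄ ∖ cl K`). With the tree's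
  `disjoint_rightDomain_leftDomain` (`RestrictionSides`): exactly one of "`i` right of `K`",
  "`i` left of `K`" holds for `i ∉ K`.

Mathlib: `IsCompact.exists_isLeast`, `intermediate_value_Icc'`, `Path.extend`,
`Filter.Tendsto.pos_mul_atTop`. Tree: `isConnected_compl_image_of_tendsto_cocompact`
(`HalfPlaneAnchors`), `JordanArcSeparation_holds` (`EilenbergCriterion`),
`isClosedEmbedding_of_tendsto_norm_atTop` (`RestrictionConfigEvents`),
`RestrictionConfig.subset_rightDomain_of_isPreconnected`, `mem_rightDomain_reflect_iff`
(`RestrictionSides`, `RestrictionLeftFillLaw`).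
-/

noncomputable section

open Set Filter Topology Metric Complex
open UpperHalfPlane (upperHalfPlaneSet)
open scoped NNReal ComplexConjugate

namespace Literature.Probability.RandomPlanarGeometry

/-! ### Simple paths from `0` to `∞` in the upper half-plane -/

/-- **A simple path from `0` to `∞` in the upper half-plane** ([LSW] Def. 3.1: "a simple curve
`γ` from `0` to infinity in the upper half-plane"): `γ : [0, ∞) → ℂ` is continuous, injective
with `γ(t) ∈ ℍ` for `t > 0` (`Loewner.IsSimpleTrace`), starts at `γ 0 = 0` and is transient,
`|γ(t)| → ∞`. (The almost sure shape of the SLE_κ trace for `κ ≤ 4`, Rohde–Schramm 2005,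
Thms. 5.1, 6.1, 7.1.) [cite: LawlerSchrammWerner2003Restriction, Def. 3.1 (p. 10)] -/
def IsChordalSimplePath (γ : ℝ≥0 → ℂ) : Prop :=
  Continuous γ ∧ Loewner.IsSimpleTrace γ ∧ γ 0 = 0 ∧ Tendsto (fun t ↦ ‖γ t‖) atTop atTop

namespace IsChordalSimplePath

variable {γ : ℝ≥0 → ℂ}

/-- A chordal simple path is continuous. [folklore] -/
theorem continuous (h : IsChordalSimplePath γ) : Continuous γ := h.1

/-- A chordal simple path is a simple trace. [folklore] -/
theorem isSimpleTrace (h : IsChordalSimplePath γ) : Loewner.IsSimpleTrace γ := h.2.1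

/-- A chordal simple path is injective. [folklore] -/
theorem injective (h : IsChordalSimplePath γ) : Function.Injective γ := h.2.1.1

/-- A chordal simple path lies in `ℍ` at positive times. [folklore] -/
theorem im_pos (h : IsChordalSimplePath γ) {t : ℝ≥0} (ht : 0 < t) : 0 < (γ t).im := h.2.1.2 t ht

/-- A chordal simple path starts at `0`. [folklore] -/
theorem apply_zero (h : IsChordalSimplePath γ) : γ 0 = 0 := h.2.2.1

/-- A chordal simple path is transient. [folklore] -/
theorem tendsto_norm (h : IsChordalSimplePath γ) : Tendsto (fun t ↦ ‖γ t‖) atTop atTop := h.2.2.2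

/-- A chordal simple path lies in the closed upper half-plane. [folklore] -/
theorem im_nonneg (h : IsChordalSimplePath γ) (t : ℝ≥0) : 0 ≤ (γ t).im := by
  rcases eq_or_ne t 0 with rfl | ht
  · rw [h.apply_zero]; simp
  · exact (h.im_pos (pos_iff_ne_zero.2 ht)).le

/-- A nonzero time gives a point of `ℍ`, so the path vanishes only at time `0`. [folklore] -/
theorem eq_zero_of_apply_eq_zero (h : IsChordalSimplePath γ) {t : ℝ≥0} (ht : γ t = 0) : t = 0 := by
  by_contra h0
  have := h.im_pos (pos_iff_ne_zero.2 h0)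
  rw [ht] at this
  simp at this

/-- The range of a chordal simple path is closed (the path is a closed embedding). [folklore] -/
theorem isClosed_range (h : IsChordalSimplePath γ) : IsClosed (range γ) :=
  (RestrictionConfig.isClosedEmbedding_of_tendsto_norm_atTop h.continuous h.injective
    h.tendsto_norm).isClosed_range

/-- `range γ = γ(0, ∞) ∪ {0}`. [folklore] -/
theorem range_eq (h : IsChordalSimplePath γ) : range γ = γ '' Ioi 0 ∪ {0} := by
  refine Subset.antisymm ?_ (union_subset (image_subset_range _ _) ?_)
  · rintro _ ⟨t, rfl⟩
    rcases eq_or_ne t 0 with rfl | ht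
    · exact Or.inr (by rw [h.apply_zero]; rfl)
    · exact Or.inl ⟨t, pos_iff_ne_zero.2 ht, rfl⟩
  · rintro _ rfl
    exact ⟨0, h.apply_zero⟩

/-- `cl γ(0, ∞) = γ[0, ∞)`. [folklore] -/
theorem closure_image_Ioi (h : IsChordalSimplePath γ) : closure (γ '' Ioi 0) = range γ := by
  refine Subset.antisymm (closure_minimal (image_subset_range _ _) h.isClosed_range) ?_
  have h1 : γ '' closure (Ioi 0) ⊆ closure (γ '' Ioi 0) :=
    image_closure_subset_closure_image h.continuous
  have h2 : closure (Ioi (0 : ℝ≥0)) = univ := by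
    rw [closure_Ioi' ⟨1, by simp⟩]
    ext t
    simp
  rw [h2, image_univ] at h1
  exact h1

/-- `γ(0, ∞) ⊆ ℍ`. [folklore] -/
theorem image_Ioi_subset (h : IsChordalSimplePath γ) : γ '' Ioi 0 ⊆ upperHalfPlaneSet := by
  rintro _ ⟨t, ht, rfl⟩
  exact h.im_pos ht

/-- `0 ∉ γ(0, ∞)`. [folklore] -/
theorem zero_notMem_image_Ioi (h : IsChordalSimplePath γ) : (0 : ℂ) ∉ γ '' Ioi 0 := fun hz ↦ by
  have := h.image_Ioi_subset hz
  simp [upperHalfPlaneSet] at this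

/-- `range γ ∩ ℍ = γ(0, ∞)`. [folklore] -/
theorem range_inter_upperHalfPlaneSet (h : IsChordalSimplePath γ) :
    range γ ∩ upperHalfPlaneSet = γ '' Ioi 0 := by
  refine Subset.antisymm ?_ fun z hz ↦ ⟨image_subset_range _ _ hz, h.image_Ioi_subset hz⟩
  rintro z ⟨hz, hzH⟩
  rcases (h.range_eq ▸ hz : z ∈ γ '' Ioi 0 ∪ {0}) with h' | h'
  · exact h'
  · rw [mem_singleton_iff.1 h'] at hzH
    simp [upperHalfPlaneSet] at hzH

/-- The point `−i` is off a chordal simple path. [folklore] -/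
theorem apply_ne_neg_I (h : IsChordalSimplePath γ) (t : ℝ≥0) : γ t ≠ -Complex.I := fun ht ↦ by
  have := h.im_nonneg t
  rw [ht] at this
  norm_num at this

/-! ### A simple path from `0` to `∞` does not separate the plane -/

/-- **A simple path from `0` to `∞` in `ℍ̄` does not separate the plane**: `ℂ ∖ γ[0, ∞)` is
connected. This is the tree's `isConnected_compl_image_of_tendsto_cocompact`
(`HalfPlaneAnchors`: the inversion `z ↦ (z − c)⁻¹`, `c = −i ∉ γ`, carries `γ[0, ∞) ∪ {∞}` to a
Jordan arc, which does not separate the plane — `JordanArcSeparation_holds`, McCleary (2006)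
Ch. 9) applied to the reparametrisation `x ↦ γ(x / (1 − x))` of `[0, 1)`.
[cite: Mccleary2006, Ch. 9, p. 130 (Separation Theorem for Jordan arcs)] -/
theorem isConnected_compl_range (h : IsChordalSimplePath γ) : IsConnected (range γ)ᶜ := by
  -- the reparametrisation `β : [0, 1) → ℂ`
  set ρ : ℝ → ℝ := fun x ↦ x / (1 - x) with hρ
  set β : ℝ → ℂ := fun x ↦ γ (ρ x).toNNReal with hβ
  have hρc : ContinuousOn ρ (Ico 0 1) := by
    refine continuousOn_id.div (continuousOn_const.sub continuousOn_id) fun x hx ↦ ?_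
    exact (sub_pos.2 hx.2).ne'
  have hβc : ContinuousOn β (Ico 0 1) :=
    h.continuous.comp_continuousOn (continuous_real_toNNReal.comp_continuousOn hρc)
  have hρinj : InjOn ρ (Ico 0 1) := by
    intro x hx y hy hxy
    have hx' : (0 : ℝ) < 1 - x := sub_pos.2 hx.2
    have hy' : (0 : ℝ) < 1 - y := sub_pos.2 hy.2
    have h' : x / (1 - x) = y / (1 - y) := hxy
    rw [div_eq_div_iff hx'.ne' hy'.ne'] at h'
    nlinarith [h']
  have hρnn : ∀ x ∈ Ico (0 : ℝ) 1, 0 ≤ ρ x := fun x hx ↦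
    div_nonneg hx.1 (sub_pos.2 hx.2).le
  have hβi : InjOn β (Ico 0 1) := by
    intro x hx y hy hxy
    have h1 : (ρ x).toNNReal = (ρ y).toNNReal := h.injective hxy
    have h2 : ρ x = ρ y := by
      have := congrArg (fun t : ℝ≥0 ↦ (t : ℝ)) h1
      simpa only [Real.coe_toNNReal _ (hρnn x hx), Real.coe_toNNReal _ (hρnn y hy)] using this
    exact hρinj hx hy h2
  -- `β → ∞` as `x → 1⁻`
  have hρtop : Tendsto ρ (𝓝[<] 1) atTop := by
    have h1 : Tendsto (fun x : ℝ ↦ x) (𝓝[<] (1 : ℝ)) (𝓝 1) :=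
      tendsto_id.mono_left nhdsWithin_le_nhds
    have h2 : Tendsto (fun x : ℝ ↦ 1 - x) (𝓝[<] (1 : ℝ)) (𝓝[>] 0) := by
      refine tendsto_nhdsWithin_iff.2 ⟨?_, ?_⟩
      · simpa using (tendsto_const_nhds (x := (1 : ℝ))).sub h1
      · exact eventually_nhdsWithin_of_forall fun x hx ↦ mem_Ioi.2 (sub_pos.2 hx)
    have h3 := h1.pos_mul_atTop one_pos (tendsto_inv_nhdsGT_zero.comp h2)
    refine h3.congr fun x ↦ ?_
    simp [hρ, div_eq_mul_inv]
  have hβinf : Tendsto β (𝓝[<] 1) (cocompact ℂ) := by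
    have hγ : Tendsto γ atTop (cocompact ℂ) := by
      rw [← Metric.cobounded_eq_cocompact]
      exact tendsto_norm_atTop_iff_cobounded.1 h.tendsto_norm
    exact hγ.comp (tendsto_real_toNNReal_atTop.comp hρtop)
  -- `β[0, 1) = γ[0, ∞)`
  have hrange : β '' Ico 0 1 = range γ := by
    refine Subset.antisymm ?_ ?_
    · rintro _ ⟨x, -, rfl⟩
      exact mem_range_self _
    · rintro _ ⟨t, rfl⟩
      have ht : (0 : ℝ) ≤ t := t.2
      have h1t : (0 : ℝ) < 1 + t := by positivity
      refine ⟨t / (1 + t), ⟨div_nonneg ht h1t.le, (div_lt_one h1t).2 (by linarith)⟩, ?_⟩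
      have hρt : ρ (t / (1 + t)) = t := by
        simp only [hρ]
        field_simp
        ring
      simp only [hβ, hρt, Real.toNNReal_coe]
  have hc : (-Complex.I : ℂ) ∉ β '' Ico 0 1 := by
    rw [hrange]
    rintro ⟨t, ht⟩
    exact h.apply_ne_neg_I t ht
  rw [← hrange]
  exact isConnected_compl_image_of_tendsto_cocompact
    Literature.Topology.PlaneTopology.JordanArcSeparation_holds hβc hβi hβinf hc

/-! ### The configuration `γ(0, ∞) ∈ Ω` of a simple path -/

/-- **A simple path from `0` to `∞` in the upper half-plane is a configuration of `Ω`**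
([LSW] Def. 3.1: "A simple example of a set `K ∈ Ω` is a simple curve `γ` from `0` to infinity
in the upper half-plane"): `K = γ(0, ∞)` is relatively closed in `ℍ` (its closure is
`γ[0, ∞) = K ∪ {0}`), connected, `cl K ∩ ℝ = {0}`, unbounded, and `ℂ ∖ cl K` is connected
(`isConnected_compl_range`). [cite: LawlerSchrammWerner2003Restriction, Def. 3.1 (p. 10)] -/
theorem image_Ioi_mem_restrictionConfigs (h : IsChordalSimplePath γ) :
    γ '' Ioi 0 ∈ restrictionConfigs := by
  refine ⟨?_, ?_, ?_, ?_, ?_⟩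
  · rw [h.closure_image_Ioi, h.range_inter_upperHalfPlaneSet]
  · exact isConnected_Ioi.image γ h.continuous.continuousOn
  · rw [h.closure_image_Ioi]
    refine Subset.antisymm ?_ ?_
    · rintro _ ⟨⟨t, rfl⟩, ⟨x, hx⟩⟩
      have him : (γ t).im = 0 := by rw [← hx]; simp
      have ht : t = 0 := by
        by_contra ht
        exact absurd him (h.im_pos (pos_iff_ne_zero.2 ht)).ne'
      rw [ht, h.apply_zero]
      rfl
    · rintro z (rfl : z = 0)
      exact ⟨⟨0, h.apply_zero⟩, ⟨0, Complex.ofReal_zero⟩⟩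
  · intro hb
    obtain ⟨R, hR⟩ := hb.subset_closedBall 0
    have hev := (h.tendsto_norm.eventually_gt_atTop R).and (Filter.eventually_gt_atTop 0)
    obtain ⟨t, ht, ht0⟩ := hev.exists
    have := hR ⟨t, ht0, rfl⟩
    rw [mem_closedBall, dist_zero_right] at this
    linarith
  · rw [h.closure_image_Ioi]
    exact h.isConnected_compl_range

/-- **The configuration `γ(0, ∞) ∈ Ω` of a simple path from `0` to `∞` in `ℍ`.**
[cite: LawlerSchrammWerner2003Restriction, Def. 3.1 (p. 10)] -/
def toConfig (h : IsChordalSimplePath γ) : RestrictionConfig :=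
  ⟨γ '' Ioi 0, h.image_Ioi_mem_restrictionConfigs⟩

/-- The underlying set of the configuration of a simple path. [folklore] -/
@[simp] theorem coe_toConfig (h : IsChordalSimplePath γ) :
    ((h.toConfig : RestrictionConfig) : Set ℂ) = γ '' Ioi 0 := rfl

/-- The closure of the configuration of a simple path is its range. [folklore] -/
theorem closure_coe_toConfig (h : IsChordalSimplePath γ) :
    closure ((h.toConfig : RestrictionConfig) : Set ℂ) = range γ := by
  rw [coe_toConfig, h.closure_image_Ioi]

/-- The configuration of a simple path is a simple path in the sense of
`RestrictionConfig.IsSimplePath`. [folklore] -/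
theorem isSimplePath_toConfig (h : IsChordalSimplePath γ) : h.toConfig.IsSimplePath :=
  ⟨γ, h.continuous, h.injective, h.apply_zero, h.tendsto_norm, rfl⟩

/-- A point of `ℍ` off the range of the path is off its configuration. [folklore] -/
theorem notMem_toConfig_of_notMem_range (h : IsChordalSimplePath γ) {z : ℂ} (hz : z ∉ range γ) :
    z ∉ ((h.toConfig : RestrictionConfig) : Set ℂ) := fun hz' ↦
  hz (image_subset_range _ _ hz')

/-- **The mirror image `t ↦ −conj (γ t)` of a simple path from `0` to `∞` in `ℍ` is one.** [folklore] -/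
theorem negConj (h : IsChordalSimplePath γ) : IsChordalSimplePath fun t ↦ -conj (γ t) := by
  refine ⟨(Complex.continuous_conj.comp h.continuous).neg, ⟨?_, fun t ht ↦ ?_⟩, ?_, ?_⟩
  · intro s t hst
    have : conj (γ s) = conj (γ t) := neg_injective hst
    exact h.injective (by simpa using congrArg conj this)
  · simpa using h.im_pos ht
  · simp [h.apply_zero]
  · simpa using h.tendsto_norm

/-- **The configuration of the mirror image is the reflection `σ`** of the configuration
(`RestrictionConfig.reflect`, `σ(x + iy) = −x + iy = −conj(x + iy)`). [folklore] -/
theorem toConfig_negConj (h : IsChordalSimplePath γ) :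
    h.negConj.toConfig = RestrictionConfig.reflect h.toConfig := by
  apply Subtype.ext
  simp only [coe_toConfig, RestrictionConfig.coe_reflect, image_image, imagAxisRefl_apply]

end IsChordalSimplePath

/-! ### The two sides of a configuration -/

namespace RestrictionConfig

variable (K : RestrictionConfig)

/-- **A point of `ℍ` off `K` is joined, inside `ℍ̄ ∖ cl K`, to a nonzero real point**: join it
to its conjugate by a path in the connected open set `ℂ ∖ cl K` ([LSW] Def. 3.1 (2)); the
initial piece of the path up to its first meeting with the real axis lies in `ℍ̄ ∖ cl K` and
ends at a real point off `cl K ∋ 0`. [folklore] -/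
theorem exists_isPreconnected_ofReal_mem {z : ℂ} (hz : 0 < z.im) (hzK : z ∉ (K : Set ℂ)) :
    ∃ T : Set ℂ, IsPreconnected T ∧ T ⊆ {w : ℂ | 0 ≤ w.im} \ closure (K : Set ℂ) ∧ z ∈ T ∧
      ∃ x : ℝ, x ≠ 0 ∧ (x : ℂ) ∈ T := by
  -- `z` and `conj z` are off `cl K = K ∪ {0}`
  have hzcl : z ∉ closure (K : Set ℂ) := by
    rw [K.closure_eq]
    rintro (h | h)
    · exact hzK h
    · rw [mem_singleton_iff.1 h] at hz
      simp at hz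
  have hzbar : conj z ∉ closure (K : Set ℂ) := fun h ↦ by
    have := K.closure_subset_setOf_im_nonneg h
    rw [mem_setOf_eq, Complex.conj_im] at this
    linarith
  -- a path from `z` to `conj z` off `cl K`
  have hO : IsOpen (closure (K : Set ℂ))ᶜ := isClosed_closure.isOpen_compl
  have hpc : IsPathConnected (closure (K : Set ℂ))ᶜ :=
    hO.isConnected_iff_isPathConnected.1 K.2.2.2.2.2
  obtain ⟨p, hp⟩ := hpc.joinedIn z hzcl (conj z) hzbar
  -- the first time the path meets the closed lower half-plane
  set f : ℝ → ℝ := fun s ↦ (p.extend s).im with hf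
  have hfc : Continuous f := Complex.continuous_im.comp p.continuous_extend
  set Z : Set ℝ := Icc 0 1 ∩ {s | f s ≤ 0} with hZ
  have hZc : IsCompact Z := isCompact_Icc.inter_right (isClosed_le hfc continuous_const)
  have h1Z : (1 : ℝ) ∈ Z := by
    refine ⟨⟨zero_le_one, le_rfl⟩, ?_⟩
    show (p.extend 1).im ≤ 0
    rw [p.extend_one, Complex.conj_im]
    linarith
  obtain ⟨s₀, hs₀Z, hs₀le⟩ := hZc.exists_isLeast ⟨1, h1Z⟩
  have hs₀I : s₀ ∈ Icc (0 : ℝ) 1 := hs₀Z.1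
  have hf0 : f 0 = z.im := by simp [hf]
  have hpos : ∀ s, 0 ≤ s → s < s₀ → 0 < f s := by
    intro s hs0 hss
    by_contra hle
    have hsZ : s ∈ Z := ⟨⟨hs0, (hss.le.trans hs₀I.2)⟩, not_lt.1 hle⟩
    exact absurd (hs₀le hsZ) (not_le.2 hss)
  have hs₀pos : 0 < s₀ := by
    rcases hs₀I.1.eq_or_lt with h | h
    · exfalso
      have : f s₀ ≤ 0 := hs₀Z.2
      rw [← h, hf0] at this
      linarith
    · exact h
  have hfs₀ : f s₀ = 0 := by
    refine le_antisymm hs₀Z.2 ?_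
    by_contra hlt
    rw [not_le] at hlt
    -- intermediate value on `[0, s₀]`: a zero before `s₀`
    have hivt := intermediate_value_Icc' hs₀I.1 hfc.continuousOn
    have h0mem : (0 : ℝ) ∈ Icc (f s₀) (f 0) := ⟨hlt.le, by rw [hf0]; exact hz.le⟩
    obtain ⟨s, ⟨hs0, hss₀⟩, hfs⟩ := hivt h0mem
    rcases hss₀.eq_or_lt with rfl | hlt'
    · exact absurd hfs hlt.ne
    · exact absurd hfs (hpos s hs0 hlt').ne'
  -- the initial piece
  refine ⟨p.extend '' Icc 0 s₀, isPreconnected_Icc.image _ p.continuous_extend.continuousOn,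
    ?_, ⟨0, ⟨le_rfl, hs₀pos.le⟩, by simp⟩, (p.extend s₀).re, ?_, ?_⟩
  · rintro _ ⟨s, ⟨hs0, hss₀⟩, rfl⟩
    refine ⟨?_, ?_⟩
    · show 0 ≤ (p.extend s).im
      rcases hss₀.eq_or_lt with rfl | hlt
      · exact hfs₀.ge
      · exact (hpos s hs0 hlt).le
    · rw [p.extend_apply ⟨hs0, hss₀.trans hs₀I.2⟩]
      exact hp _
  · intro hre
    have him : (p.extend s₀).im = 0 := hfs₀
    have h0 : p.extend s₀ = 0 := Complex.ext (by simp [hre]) (by simp [him])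
    have : p.extend s₀ ∉ closure (K : Set ℂ) := by
      rw [p.extend_apply hs₀I]
      exact hp _
    exact this (h0 ▸ K.zero_mem_closure)
  · have him : (p.extend s₀).im = 0 := hfs₀
    have : ((p.extend s₀).re : ℂ) = p.extend s₀ := Complex.ext (by simp) (by simp [him])
    rw [this]
    exact ⟨s₀, ⟨hs₀pos.le, le_rfl⟩, rfl⟩

/-- **The two sides of a configuration**: a point of `ℍ` off `K ∈ Ω` lies in the right domain
or in the left domain of `K` (it is joined inside `ℍ̄ ∖ cl K` to a nonzero real point, which
lies in the right domain if positive and in the left domain if negative; the left case is the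
right case for the reflected configuration `σK`). Together with
`disjoint_rightDomain_leftDomain`: exactly one of the two. This is the dichotomy "`i` ends up to
the right / to the left of the path" of the proof of [LSW] Cor. 8.6 (p. 38) for simple paths.
[cite: LawlerSchrammWerner2003Restriction, proof of Cor. 8.6 (p. 38)] -/
theorem mem_rightDomain_or_mem_leftDomain {z : ℂ} (hz : 0 < z.im) (hzK : z ∉ (K : Set ℂ)) :
    z ∈ K.rightDomain ∨ z ∈ K.leftDomain := by
  obtain ⟨T, hT, hTsub, hzT, x, hx, hxT⟩ := K.exists_isPreconnected_ofReal_mem hz hzK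
  rcases lt_or_gt_of_ne hx with hneg | hpos
  · -- reflect: `σT` joins `σz` to `−x > 0` in `ℍ̄ ∖ cl(σK)`
    right
    have hmem : imagAxisRefl z ∈ (reflect K).rightDomain := by
      refine (reflect K).subset_rightDomain_of_isPreconnected
        (hT.image _ imagAxisRefl.continuous.continuousOn) ?_ (mem_image_of_mem _ hxT) ?_
        (mem_image_of_mem _ hzT)
      · rintro _ ⟨w, hw, rfl⟩
        refine ⟨by simpa using (hTsub hw).1, fun hcl ↦ (hTsub hw).2 ?_⟩
        rw [coe_reflect, ← imagAxisRefl.image_closure] at hcl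
        obtain ⟨w', hw', hww'⟩ := hcl
        rwa [← imagAxisRefl.injective hww']
      · rw [imagAxisRefl_ofReal]
        exact (reflect K).ofReal_mem_rightDomain (by simpa using hneg)
    rwa [mem_rightDomain_reflect_iff, imagAxisRefl_imagAxisRefl] at hmem
  · left
    exact K.subset_rightDomain_of_isPreconnected hT hTsub hxT (K.ofReal_mem_rightDomain hpos) hzT

/-- For a point `z ∈ ℍ` off `K ∈ Ω`: `z` is NOT to the right of `K` iff it is to the left.
[cite: LawlerSchrammWerner2003Restriction, proof of Cor. 8.6 (p. 38)] -/
theorem notMem_rightDomain_iff_mem_leftDomain {z : ℂ} (hz : 0 < z.im) (hzK : z ∉ (K : Set ℂ)) :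
    z ∉ K.rightDomain ↔ z ∈ K.leftDomain := by
  refine ⟨fun h ↦ (K.mem_rightDomain_or_mem_leftDomain hz hzK).resolve_left h, fun h h' ↦ ?_⟩
  exact Set.disjoint_left.1 K.disjoint_rightDomain_leftDomain h' h

end RestrictionConfig

end Literature.Probability.RandomPlanarGeometry

end
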